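import Mathlib
import Summits.HodgeConjecture.HodgeConjecture.Theorems.HodgeLocusCensusUnitColumnRankD3
import Summits.HodgeConjecture.HodgeConjecture.Theorems.HodgeLocusCensusUnitColumnRankD3Levels
import Summits.HodgeConjecture.HodgeConjecture.Theorems.HodgeLocusCensusInclusionPowers
import Literature.Combinatorics.Posets.BooleanOrderRaising

/-!
# THEOREM L at `d = 3`, `c′ = 2, 3`, EVERY level: `rank (×ℓ^{c′} : B_{k−j−c′} → B_{k−j}) = min (C(k,j), C(k,j+c′))` (characteristic `0`)
— ENGINE B gen 50 PROBE 3 (successor material O-113; not an item; imports ITEM B50-POWERS `HodgeLocusCensusInclusionPowers` BY NAME)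

certified instances and evidence bearing on the general Hodge conjecture; no claim.

Model `B = K[x₁,…,x_k]/(xᵢ²)`, `ℓ = Σ xᵢ`, anchor 172/174/179 convention (`B_{k−j}` indexed by `v : Fin k → Fin 2` with `Σ vᵢ + j = k·1`).
The matrices are anchor 179's THEOREMS (ii) and (iii) with the literals freed: rows `{v // Σ vᵢ + j = k}`, columns `{m // Σ mᵢ + (j + c′) = k}`,
entry = multiplicity of `ofFn v` in `(colR 3 (ofFn m)).flatMap (colR 3)` (`c′ = 2`) resp. `((colR 3 (ofFn m)).flatMap (colR 3)).flatMap (colR 3)`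
(`c′ = 3`), read off gen 31's `colR 3`.
* `count_flatMap_colR_ind` — summing over the column list of `x^{𝟙_S}` is summing over `i ∈ S` (anchor 179 `mem_colR_ind_iff`, anchor 174 `colR_nodup`);
* `count_colR_ind`, `count_colR2_ind`, `count_colR3_ind` — the multiplicity of `x^{𝟙_T}` in `ℓ^{c′}·x^{𝟙_S}` is `c′! · [T ⊆ S, |S| = |T| + c′]`
  (`c′ = 1, 2, 3`; the `c′` zeros of `𝟙_S` outside `T` can be raised in any order: `sum_ind_erase`);
* `rank_eq_rank_ind` — transport of any census matrix along the zero-set bijections (anchor 179 bookkeeping by name);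
* `rank_mulL2_d3_onto/into`, `rank_mulL2_d3`, `rank_mulL3_d3_onto/into`, `rank_mulL3_d3` — the ranks, from the general-`c` Gottlieb–Kantor theorem
  `rank_incl_pow` of B50-POWERS (`Theorems/HodgeLocusCensusInclusionPowers.lean`, namespace `…Census.InclusionPowers`: `rank [T ⊆ S]_{|T| = j, |S| = j + c} = min (C(n,j), C(n,j+c))` in characteristic `0`) after dividing
  the entries by `c′!` (`rank_smul_of_ne_zero`).
Characteristic `0` is essential twice: `c′!` must be invertible (anchor 188/191: the `c′ = 2, 3` matrices vanish identically in characteristics `2`, `3`),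
and Gottlieb–Kantor fails modulo small primes.
-/

set_option linter.dupNamespace false
set_option autoImplicit false

namespace Summit.HodgeConjecture.HodgeConjecture.HodgeLocus.Census.UnitColumnRankD3LevelsPowers

open Summit.HodgeConjecture.HodgeConjecture.HodgeLocus.Census.ModelNonJumpC1All (colR)
open Summit.HodgeConjecture.HodgeConjecture.HodgeLocus.Census.UnitColumnRankD4 (colR_nodup)
open Summit.HodgeConjecture.HodgeConjecture.HodgeLocus.Census.UnitColumnRankD3 (eq_ind_filter card_filter_eq sum_ind card_level mem_colR_ind_iff
  ofFn_val_inj)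
open Summit.HodgeConjecture.HodgeConjecture.HodgeLocus.Census.UnitColumnRankD3Levels (ind_inj colR_ind_iff)
open Summit.HodgeConjecture.HodgeConjecture.HodgeLocus.Census.InclusionPowers (rank_incl_pow rank_incl_pow_onto rank_incl_pow_into)

/-! ## Summing over the column list of an indicator monomial -/

/-- the indicator WORD `ofFn 𝟙_S` determines `S` -/
theorem ind_word_inj {k : ℕ} {S T : Finset (Fin k)}
    (h : (List.ofFn fun l => ((if l ∈ S then (0 : Fin 2) else 1 : Fin 2) : ℕ)) =
      List.ofFn fun l => ((if l ∈ T then (0 : Fin 2) else 1 : Fin 2) : ℕ)) : S = T :=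
  ind_inj ((ofFn_val_inj _ _).mp h)

/-- the column list of `x^{𝟙_S}` as a finset: the words of `𝟙_{S ∖ i}`, `i ∈ S` -/
theorem colR_ind_toFinset {k : ℕ} (S : Finset (Fin k)) :
    (colR 3 (List.ofFn fun l => ((if l ∈ S then (0 : Fin 2) else 1 : Fin 2) : ℕ))).toFinset =
      S.image (fun i => List.ofFn fun l => ((if l ∈ S.erase i then (0 : Fin 2) else 1 : Fin 2) : ℕ)) := by
  ext x
  rw [List.mem_toFinset, mem_colR_ind_iff, Finset.mem_image]
  constructor
  · rintro ⟨i, hi, rfl⟩; exact ⟨i, hi, rfl⟩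
  · rintro ⟨i, hi, rfl⟩; exact ⟨i, hi, rfl⟩

/-- counting in a flat-map over the column list of `x^{𝟙_S}` = summing over `i ∈ S` (the list has no duplicates: anchor 174 `colR_nodup`) -/
theorem count_flatMap_colR_ind {k : ℕ} (S : Finset (Fin k)) (F : List ℕ → List (List ℕ)) (w : List ℕ) :
    ((colR 3 (List.ofFn fun l => ((if l ∈ S then (0 : Fin 2) else 1 : Fin 2) : ℕ))).flatMap F).count w =
      ∑ i ∈ S, (F (List.ofFn fun l => ((if l ∈ S.erase i then (0 : Fin 2) else 1 : Fin 2) : ℕ))).count w := by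
  rw [List.count_flatMap, ← List.sum_toFinset _ (colR_nodup 3 le_rfl _), colR_ind_toFinset, Finset.sum_image]
  · rfl
  · intro i hi i' hi' h
    exact Finset.erase_injOn S hi hi' (ind_word_inj h)

/-! ## Multiplicities between indicator monomials: `c′! · [T ⊆ S, |S| = |T| + c′]` -/

/-- `T = S ∖ i` for some `i ∈ S` iff `T ⊆ S` and `|S| = |T| + 1` -/
theorem exists_erase_iff {k : ℕ} (S T : Finset (Fin k)) : (∃ i ∈ S, T = S.erase i) ↔ T ⊆ S ∧ S.card = T.card + 1 := by
  constructor
  · rintro ⟨i, hi, rfl⟩; exact ⟨Finset.erase_subset i S, (Finset.card_erase_add_one hi).symm⟩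
  · rintro ⟨hTS, hc⟩
    have h1 : (S \ T).card = 1 := by rw [Finset.card_sdiff_of_subset hTS]; omega
    obtain ⟨i, hi⟩ := Finset.card_eq_one.mp h1
    have hiS : i ∈ S \ T := by rw [hi]; exact Finset.mem_singleton_self i
    rw [Finset.mem_sdiff] at hiS
    refine ⟨i, hiS.1, Finset.ext fun l => ?_⟩
    rw [Finset.mem_erase]
    constructor
    · intro hl; exact ⟨fun h => hiS.2 (h ▸ hl), hTS hl⟩
    · rintro ⟨hli, hlS⟩
      by_contra hlT
      have h2 : l ∈ S \ T := Finset.mem_sdiff.mpr ⟨hlS, hlT⟩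
      rw [hi, Finset.mem_singleton] at h2
      exact hli h2

/-- `c′ = 1`: the multiplicity of `x^{𝟙_T}` in `ℓ·x^{𝟙_S}` is `[T ⊆ S, |S| = |T| + 1]` -/
theorem count_colR_ind {k : ℕ} (S T : Finset (Fin k)) :
    (colR 3 (List.ofFn fun l => ((if l ∈ S then (0 : Fin 2) else 1 : Fin 2) : ℕ))).count
        (List.ofFn fun l => ((if l ∈ T then (0 : Fin 2) else 1 : Fin 2) : ℕ)) = if T ⊆ S ∧ S.card = T.card + 1 then 1 else 0 := by
  by_cases h : T ⊆ S ∧ S.card = T.card + 1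
  · rw [if_pos h]
    exact List.count_eq_one_of_mem (colR_nodup 3 le_rfl _) ((colR_ind_iff S T).mpr ((exists_erase_iff S T).mpr h))
  · rw [if_neg h]
    exact List.count_eq_zero.mpr fun hm => h ((exists_erase_iff S T).mp ((colR_ind_iff S T).mp hm))

/-- raising the zeros outside `T` in any order: `Σ_{i ∈ S} a·[T ⊆ S ∖ i, |S ∖ i| = |T| + c] = (c+1)·a·[T ⊆ S, |S| = |T| + c + 1]` -/
theorem sum_ind_erase {k : ℕ} (S T : Finset (Fin k)) (c a : ℕ) :
    (∑ i ∈ S, if T ⊆ S.erase i ∧ (S.erase i).card = T.card + c then a else 0) =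
      if T ⊆ S ∧ S.card = T.card + (c + 1) then (c + 1) * a else 0 := by
  have key : ∀ i ∈ S, (T ⊆ S.erase i ∧ (S.erase i).card = T.card + c) ↔ (i ∈ S \ T ∧ (T ⊆ S ∧ S.card = T.card + (c + 1))) := by
    intro i hi
    rw [Finset.subset_erase, Finset.mem_sdiff, Finset.card_erase_of_mem hi]
    have hpos := Finset.card_pos.mpr ⟨i, hi⟩
    constructor
    · rintro ⟨⟨hTS, hiT⟩, hc⟩; exact ⟨⟨hi, hiT⟩, hTS, by omega⟩
    · rintro ⟨⟨-, hiT⟩, hTS, hc⟩; exact ⟨⟨hTS, hiT⟩, by omega⟩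
  rw [Finset.sum_congr rfl (fun i hi => if_congr (key i hi) rfl rfl)]
  by_cases h : T ⊆ S ∧ S.card = T.card + (c + 1)
  · simp only [h, and_true, if_true]
    rw [Finset.sum_ite_mem, Finset.sum_const, smul_eq_mul, Finset.inter_eq_right.mpr Finset.sdiff_subset, Finset.card_sdiff_of_subset h.1, h.2,
      Nat.add_sub_cancel_left]
  · simp only [h, and_false, if_false, Finset.sum_const_zero]

/-- `c′ = 2`: the multiplicity of `x^{𝟙_T}` in `ℓ²·x^{𝟙_S}` is `2·[T ⊆ S, |S| = |T| + 2]` -/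
theorem count_colR2_ind {k : ℕ} (S T : Finset (Fin k)) :
    ((colR 3 (List.ofFn fun l => ((if l ∈ S then (0 : Fin 2) else 1 : Fin 2) : ℕ))).flatMap (colR 3)).count
        (List.ofFn fun l => ((if l ∈ T then (0 : Fin 2) else 1 : Fin 2) : ℕ)) = if T ⊆ S ∧ S.card = T.card + 2 then 2 else 0 := by
  rw [count_flatMap_colR_ind]
  simp_rw [count_colR_ind]
  rw [sum_ind_erase S T 1 1]

/-- `c′ = 3`: the multiplicity of `x^{𝟙_T}` in `ℓ³·x^{𝟙_S}` is `6·[T ⊆ S, |S| = |T| + 3]` -/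
theorem count_colR3_ind {k : ℕ} (S T : Finset (Fin k)) :
    (((colR 3 (List.ofFn fun l => ((if l ∈ S then (0 : Fin 2) else 1 : Fin 2) : ℕ))).flatMap (colR 3)).flatMap (colR 3)).count
        (List.ofFn fun l => ((if l ∈ T then (0 : Fin 2) else 1 : Fin 2) : ℕ)) = if T ⊆ S ∧ S.card = T.card + 3 then 6 else 0 := by
  rw [List.flatMap_assoc, count_flatMap_colR_ind]
  simp_rw [count_colR2_ind]
  rw [sum_ind_erase S T 2 2]

/-! ## Transport to the census matrices (anchor 179's index convention) -/

/-- along the zero-set bijections `v ↦ {l | v l = 0}` any census matrix is the same matrix on indicators `𝟙_T`, `𝟙_S` -/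
theorem rank_eq_rank_ind (K : Type*) [Field K] (k a b : ℕ) (f : (Fin k → Fin 2) → (Fin k → Fin 2) → K) :
    (Matrix.of fun (v : {v : Fin k → Fin 2 // (∑ i, (v i : ℕ)) + a = k * 1}) (m : {m : Fin k → Fin 2 // (∑ i, (m i : ℕ)) + b = k * 1}) =>
      f v.1 m.1).rank =
    (Matrix.of fun (T : {S : Finset (Fin k) // S.card = a}) (S : {S : Finset (Fin k) // S.card = b}) =>
      f (fun l => if l ∈ T.1 then 0 else 1) (fun l => if l ∈ S.1 then 0 else 1)).rank := by
  let eR : {v : Fin k → Fin 2 // (∑ i, (v i : ℕ)) + a = k * 1} ≃ {S : Finset (Fin k) // S.card = a} :=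
    { toFun := fun v => ⟨Finset.univ.filter (fun l => v.1 l = 0), card_filter_eq v.1 v.2⟩
      invFun := fun s => ⟨fun l => if l ∈ s.1 then 0 else 1, by have h := sum_ind s.1; rw [s.2] at h; exact h⟩
      left_inv := fun v => Subtype.ext (eq_ind_filter v.1).symm
      right_inv := fun s => Subtype.ext (by ext l; by_cases hl : l ∈ s.1 <;> simp [hl]) }
  let eC : {m : Fin k → Fin 2 // (∑ i, (m i : ℕ)) + b = k * 1} ≃ {S : Finset (Fin k) // S.card = b} :=
    { toFun := fun v => ⟨Finset.univ.filter (fun l => v.1 l = 0), card_filter_eq v.1 v.2⟩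
      invFun := fun s => ⟨fun l => if l ∈ s.1 then 0 else 1, by have h := sum_ind s.1; rw [s.2] at h; exact h⟩
      left_inv := fun v => Subtype.ext (eq_ind_filter v.1).symm
      right_inv := fun s => Subtype.ext (by ext l; by_cases hl : l ∈ s.1 <;> simp [hl]) }
  rw [← Matrix.rank_reindex eR eC]
  rfl

/-- a nonzero scalar does not change the rank -/
theorem rank_smul_of_ne_zero {m n K : Type*} [Fintype n] [DecidableEq n] [Field K] (A : Matrix m n K) (c : K) (hc : c ≠ 0) :
    (c • A).rank = A.rank := by
  have h : c • A = A * (c • (1 : Matrix n n K)) := by rw [Matrix.mul_smul, Matrix.mul_one]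
  rw [h]
  refine Matrix.rank_mul_eq_left_of_isUnit_det _ _ ?_
  rw [Matrix.det_smul, Matrix.det_one, mul_one]
  exact isUnit_iff_ne_zero.mpr (pow_ne_zero _ hc)

/-! ## `c′ = 2`: `×ℓ² : B_{k−j−2} → B_{k−j}` -/

/-- the `×ℓ²` census matrix in level `j` has the rank of the `j`-sets-versus-`(j+2)`-sets inclusion matrix (entries divided by `2`) -/
theorem rank_mulL2_d3_eq_rank_incl (K : Type*) [Field K] [CharZero K] (k j : ℕ) :
    (Matrix.of fun (v : {v : Fin k → Fin 2 // (∑ i, (v i : ℕ)) + j = k * 1}) (m : {m : Fin k → Fin 2 // (∑ i, (m i : ℕ)) + (j + 2) = k * 1}) =>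
      ((((colR 3 (List.ofFn fun i => (m.1 i : ℕ))).flatMap (colR 3)).count (List.ofFn fun i => (v.1 i : ℕ)) : ℕ) : K)).rank =
    (Matrix.of fun (T : {S : Finset (Fin k) // S.card = j}) (S : {S : Finset (Fin k) // S.card = j + 2}) =>
        if T.1 ⊆ S.1 then (1 : K) else 0).rank := by
  have h := rank_eq_rank_ind K k j (j + 2)
    (fun v m => ((((colR 3 (List.ofFn fun i => (m i : ℕ))).flatMap (colR 3)).count (List.ofFn fun i => (v i : ℕ)) : ℕ) : K))
  simp only at h
  rw [h]
  have hE : (Matrix.of fun (T : {S : Finset (Fin k) // S.card = j}) (S : {S : Finset (Fin k) // S.card = j + 2}) =>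
      ((((colR 3 (List.ofFn fun i => ((if i ∈ S.1 then (0 : Fin 2) else 1 : Fin 2) : ℕ))).flatMap (colR 3)).count
        (List.ofFn fun i => ((if i ∈ T.1 then (0 : Fin 2) else 1 : Fin 2) : ℕ)) : ℕ) : K)) =
      (2 : K) • (Matrix.of fun (T : {S : Finset (Fin k) // S.card = j}) (S : {S : Finset (Fin k) // S.card = j + 2}) =>
        if T.1 ⊆ S.1 then (1 : K) else 0) := by
    ext T S
    simp only [Matrix.of_apply, Matrix.smul_apply, smul_eq_mul]
    rw [count_colR2_ind S.1 T.1]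
    by_cases hTS : T.1 ⊆ S.1
    · rw [if_pos ⟨hTS, by rw [S.2, T.2]⟩, if_pos hTS]; norm_num
    · rw [if_neg (fun h' => hTS h'.1), if_neg hTS]; norm_num
  rw [hE, rank_smul_of_ne_zero _ _ two_ne_zero]

/-- **`2j + 2 ≤ k`: `×ℓ² : B_{k−j−2} → B_{k−j}` is ONTO** — rank `=` number of rows `= C(k,j)` (characteristic `0`) -/
theorem rank_mulL2_d3_onto (K : Type*) [Field K] [CharZero K] (k j : ℕ) (hj : 2 * j + 2 ≤ k) :
    (Matrix.of fun (v : {v : Fin k → Fin 2 // (∑ i, (v i : ℕ)) + j = k * 1}) (m : {m : Fin k → Fin 2 // (∑ i, (m i : ℕ)) + (j + 2) = k * 1}) =>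
      ((((colR 3 (List.ofFn fun i => (m.1 i : ℕ))).flatMap (colR 3)).count (List.ofFn fun i => (v.1 i : ℕ)) : ℕ) : K)).rank =
      Fintype.card {v : Fin k → Fin 2 // (∑ i, (v i : ℕ)) + j = k * 1} := by
  rw [rank_mulL2_d3_eq_rank_incl, rank_incl_pow_onto K j 2 (by rwa [Fintype.card_fin]), Fintype.card_fin, card_level]

/-- **`k ≤ 2j + 2`: `×ℓ² : B_{k−j−2} → B_{k−j}` is ONE-TO-ONE** — rank `=` number of columns `= C(k,j+2)` (characteristic `0`) -/
theorem rank_mulL2_d3_into (K : Type*) [Field K] [CharZero K] (k j : ℕ) (hj : k ≤ 2 * j + 2) :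
    (Matrix.of fun (v : {v : Fin k → Fin 2 // (∑ i, (v i : ℕ)) + j = k * 1}) (m : {m : Fin k → Fin 2 // (∑ i, (m i : ℕ)) + (j + 2) = k * 1}) =>
      ((((colR 3 (List.ofFn fun i => (m.1 i : ℕ))).flatMap (colR 3)).count (List.ofFn fun i => (v.1 i : ℕ)) : ℕ) : K)).rank =
      Fintype.card {m : Fin k → Fin 2 // (∑ i, (m i : ℕ)) + (j + 2) = k * 1} := by
  rw [rank_mulL2_d3_eq_rank_incl, rank_incl_pow_into K j 2 (by rwa [Fintype.card_fin]), Fintype.card_fin, card_level]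

/-- **THEOREM L at `d = 3`, `c′ = 2`, every level: `rank (×ℓ² : B_{k−j−2} → B_{k−j}) = min (C(k,j), C(k,j+2))`** (characteristic `0`) -/
theorem rank_mulL2_d3 (K : Type*) [Field K] [CharZero K] (k j : ℕ) :
    (Matrix.of fun (v : {v : Fin k → Fin 2 // (∑ i, (v i : ℕ)) + j = k * 1}) (m : {m : Fin k → Fin 2 // (∑ i, (m i : ℕ)) + (j + 2) = k * 1}) =>
      ((((colR 3 (List.ofFn fun i => (m.1 i : ℕ))).flatMap (colR 3)).count (List.ofFn fun i => (v.1 i : ℕ)) : ℕ) : K)).rank =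
      min (k.choose j) (k.choose (j + 2)) := by
  rw [rank_mulL2_d3_eq_rank_incl, rank_incl_pow K j 2, Fintype.card_fin]

/-! ## `c′ = 3`: `×ℓ³ : B_{k−j−3} → B_{k−j}` -/

/-- the `×ℓ³` census matrix in level `j` has the rank of the `j`-sets-versus-`(j+3)`-sets inclusion matrix (entries divided by `6`) -/
theorem rank_mulL3_d3_eq_rank_incl (K : Type*) [Field K] [CharZero K] (k j : ℕ) :
    (Matrix.of fun (v : {v : Fin k → Fin 2 // (∑ i, (v i : ℕ)) + j = k * 1}) (m : {m : Fin k → Fin 2 // (∑ i, (m i : ℕ)) + (j + 3) = k * 1}) =>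
      (((((colR 3 (List.ofFn fun i => (m.1 i : ℕ))).flatMap (colR 3)).flatMap (colR 3)).count (List.ofFn fun i => (v.1 i : ℕ)) : ℕ) : K)).rank =
    (Matrix.of fun (T : {S : Finset (Fin k) // S.card = j}) (S : {S : Finset (Fin k) // S.card = j + 3}) =>
        if T.1 ⊆ S.1 then (1 : K) else 0).rank := by
  have h := rank_eq_rank_ind K k j (j + 3)
    (fun v m => (((((colR 3 (List.ofFn fun i => (m i : ℕ))).flatMap (colR 3)).flatMap (colR 3)).count (List.ofFn fun i => (v i : ℕ)) : ℕ) : K))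
  simp only at h
  rw [h]
  have hE : (Matrix.of fun (T : {S : Finset (Fin k) // S.card = j}) (S : {S : Finset (Fin k) // S.card = j + 3}) =>
      (((((colR 3 (List.ofFn fun i => ((if i ∈ S.1 then (0 : Fin 2) else 1 : Fin 2) : ℕ))).flatMap (colR 3)).flatMap (colR 3)).count
        (List.ofFn fun i => ((if i ∈ T.1 then (0 : Fin 2) else 1 : Fin 2) : ℕ)) : ℕ) : K)) =
      (6 : K) • (Matrix.of fun (T : {S : Finset (Fin k) // S.card = j}) (S : {S : Finset (Fin k) // S.card = j + 3}) =>
        if T.1 ⊆ S.1 then (1 : K) else 0) := by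
    ext T S
    simp only [Matrix.of_apply, Matrix.smul_apply, smul_eq_mul]
    rw [count_colR3_ind S.1 T.1]
    by_cases hTS : T.1 ⊆ S.1
    · rw [if_pos ⟨hTS, by rw [S.2, T.2]⟩, if_pos hTS]; norm_num
    · rw [if_neg (fun h' => hTS h'.1), if_neg hTS]; norm_num
  rw [hE, rank_smul_of_ne_zero _ _ (by norm_num : (6 : K) ≠ 0)]

/-- **`2j + 3 ≤ k`: `×ℓ³ : B_{k−j−3} → B_{k−j}` is ONTO** — rank `=` number of rows `= C(k,j)` (characteristic `0`) -/
theorem rank_mulL3_d3_onto (K : Type*) [Field K] [CharZero K] (k j : ℕ) (hj : 2 * j + 3 ≤ k) :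
    (Matrix.of fun (v : {v : Fin k → Fin 2 // (∑ i, (v i : ℕ)) + j = k * 1}) (m : {m : Fin k → Fin 2 // (∑ i, (m i : ℕ)) + (j + 3) = k * 1}) =>
      (((((colR 3 (List.ofFn fun i => (m.1 i : ℕ))).flatMap (colR 3)).flatMap (colR 3)).count (List.ofFn fun i => (v.1 i : ℕ)) : ℕ) : K)).rank =
      Fintype.card {v : Fin k → Fin 2 // (∑ i, (v i : ℕ)) + j = k * 1} := by
  rw [rank_mulL3_d3_eq_rank_incl, rank_incl_pow_onto K j 3 (by rwa [Fintype.card_fin]), Fintype.card_fin, card_level]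

/-- **`k ≤ 2j + 3`: `×ℓ³ : B_{k−j−3} → B_{k−j}` is ONE-TO-ONE** — rank `=` number of columns `= C(k,j+3)` (characteristic `0`) -/
theorem rank_mulL3_d3_into (K : Type*) [Field K] [CharZero K] (k j : ℕ) (hj : k ≤ 2 * j + 3) :
    (Matrix.of fun (v : {v : Fin k → Fin 2 // (∑ i, (v i : ℕ)) + j = k * 1}) (m : {m : Fin k → Fin 2 // (∑ i, (m i : ℕ)) + (j + 3) = k * 1}) =>
      (((((colR 3 (List.ofFn fun i => (m.1 i : ℕ))).flatMap (colR 3)).flatMap (colR 3)).count (List.ofFn fun i => (v.1 i : ℕ)) : ℕ) : K)).rank =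
      Fintype.card {m : Fin k → Fin 2 // (∑ i, (m i : ℕ)) + (j + 3) = k * 1} := by
  rw [rank_mulL3_d3_eq_rank_incl, rank_incl_pow_into K j 3 (by rwa [Fintype.card_fin]), Fintype.card_fin, card_level]

/-- **THEOREM L at `d = 3`, `c′ = 3`, every level: `rank (×ℓ³ : B_{k−j−3} → B_{k−j}) = min (C(k,j), C(k,j+3))`** (characteristic `0`) -/
theorem rank_mulL3_d3 (K : Type*) [Field K] [CharZero K] (k j : ℕ) :
    (Matrix.of fun (v : {v : Fin k → Fin 2 // (∑ i, (v i : ℕ)) + j = k * 1}) (m : {m : Fin k → Fin 2 // (∑ i, (m i : ℕ)) + (j + 3) = k * 1}) =>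
      (((((colR 3 (List.ofFn fun i => (m.1 i : ℕ))).flatMap (colR 3)).flatMap (colR 3)).count (List.ofFn fun i => (v.1 i : ℕ)) : ℕ) : K)).rank =
      min (k.choose j) (k.choose (j + 3)) := by
  rw [rank_mulL3_d3_eq_rank_incl, rank_incl_pow K j 3, Fintype.card_fin]

end Summit.HodgeConjecture.HodgeConjecture.HodgeLocus.Census.UnitColumnRankD3LevelsPowers
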